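import Mathlib.Analysis.Matrix.Normed
import Mathlib.Analysis.Calculus.FDeriv.Mul
import Mathlib.Analysis.Calculus.Deriv.Mul
import Mathlib.Analysis.Calculus.Deriv.Add
import Mathlib.Analysis.Calculus.Deriv.Comp
import Mathlib.Analysis.Normed.Ring.Units
import Mathlib.Analysis.Complex.Basic
import Mathlib.LinearAlgebra.Matrix.NonsingularInverse
import Mathlib.Data.Matrix.Basis

/-!
# `BalabanUV.Beta.FP.MatrixInvDeriv` — road «FP» for binder row D1, leaf H2-P, generic tool for row H2-P-KER's RATE (the «PINF-CHAIN» step):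
# DERIVATIVES ALONG A REAL PARAMETER OF CURVES OF COMPLEX MATRICES — entrywise ⇄ matrix-valued, products, and the INVERSE
# `(A⁻¹)′ = −A⁻¹·A′·A⁻¹` where `det A ≠ 0`, with the entrywise formula

HONEST DEPENDENCY (page 1, mandatory): continuum YM on T⁴ ⇐ BetaPertH ∧ nine spine estimates (0/9 proved); BetaPertH ⇐ (D1) ∧ (D4) ∧ CAP+tail;
G-an2-4 gates asym, D1 and NE2/3/4.  HONEST FRAMING (cell contract, verbatim): «discharging `BetaPertH` makes Bałaban's UV stability UNCONDITIONAL —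
a real constructive-QFT result; it is NOT the continuum limit and NOT the Clay problem.»  THIS MODULE DISCHARGES NOTHING of the wall: [folklore] matrix
calculus over Mathlib (`hasFDerivAt_ringInverse` in the scoped `L∞`-operator normed algebra `Matrix.Norms.Operator` — the pattern of the tree's
`Literature/Geometry/Riemannian/VolumeSphereTheoremProofs.hasDerivAt_matrix_inv` for REAL matrices, here for COMPLEX matrices along a REAL parameter — plus the
entrywise dictionary).  No `def`, no `def … : Prop`, nothing cited as a hypothesis, 0 sorry; 0 wall binders; NOT D1, NOT BetaPertH, NOT continuum, NOT Clay.

ABSOLUTE RULE (cell charter, verbatim): «No internally-minted statement may enter as a cited fact. Every hypothesis is either kernel-proved in this package or a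
verbatim quotation of a PUBLISHED theorem with page reference. The manuscript(s) under audit are NOT citable for their own disputed steps — they are the thing
under adjudication; programme-internal (2001/route/tribunal) claims are never citable.»

WHAT (`A B : ℝ → Matrix ι ι ℂ`, `t : ℝ`; the matrix norm is Mathlib's scoped `L∞`-operator norm — derivatives do not depend on this choice, the topology
being the product one):
* §1 `hasDerivAt_entry` (matrix-valued derivative ⟹ each entry), **`hasDerivAt_of_entries`** (entrywise derivatives ⟹ matrix-valued: `A = Σ (A α β) • single α β 1`).
* §2 `hasDerivAt_matrix_mul` ∕ **`hasDerivAt_mul_entry`** (Leibniz, entrywise: `((A·B) α β)′ = (A′·B + A·B′) α β`).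
* §3 **`hasDerivAt_matrix_inv`** (`(A⁻¹)′ = −A⁻¹·A′·A⁻¹` at `t` with `IsUnit (A t).det`), **`hasDerivAt_inv_entry`**
  (`((A⁻¹) α β)′ = −Σ_{γ,δ} A⁻¹ α γ·A′ γ δ·A⁻¹ δ β` from ENTRYWISE hypotheses) — the step every member of a derivative chain of `PinfSym = feynMat⁻¹`
  (p231001) along a coordinate line takes (consumers: «H2-P-SPLIT-B»'s `B`, W166-HOLO's real-line package, `PuncturedCoordDeriv`'s `hder`).
Provenance: G-an2-4 swarm leaf prover 05, gen 34 (prover-b2b-balaban-gan24-formalise-leaf-05-g34-0), cross-lane on road FP, 2026-08-20.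
-/

noncomputable section

namespace Summit.QuantumFields.BalabanUV.Beta.FP.MatrixInvDeriv

open Matrix Filter
open scoped Matrix.Norms.Operator BigOperators

variable {ι : Type*} [Fintype ι] [DecidableEq ι]

/-! ## §1 Entrywise ⇄ matrix-valued derivatives -/

omit [DecidableEq ι] in
/-- [folklore] a matrix-valued derivative gives the derivative of every entry (entry evaluation is a continuous linear map). -/
theorem hasDerivAt_entry {A : ℝ → Matrix ι ι ℂ} {A' : Matrix ι ι ℂ} {t : ℝ} (h : HasDerivAt A A' t) (α β : ι) :
    HasDerivAt (fun s => A s α β) (A' α β) t := by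
  set L : Matrix ι ι ℂ →L[ℝ] ℂ := LinearMap.toContinuousLinearMap (Matrix.entryLinearMap ℝ ℂ α β) with hL
  have h2 : HasDerivAt (fun s => L (A s)) (L A') t := L.hasFDerivAt.comp_hasDerivAt t h
  exact h2

/-- [folklore] **ENTRYWISE DERIVATIVES GIVE THE MATRIX-VALUED DERIVATIVE** (`A = Σ_{α,β} (A α β) • single α β 1`, finite sum). -/
theorem hasDerivAt_of_entries {A : ℝ → Matrix ι ι ℂ} {A' : Matrix ι ι ℂ} {t : ℝ}
    (h : ∀ α β, HasDerivAt (fun s => A s α β) (A' α β) t) : HasDerivAt A A' t := by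
  have hdec : ∀ M : Matrix ι ι ℂ, M = ∑ α, ∑ β, M α β • Matrix.single α β (1 : ℂ) := fun M => by
    conv_lhs => rw [Matrix.matrix_eq_sum_single M]
    refine Finset.sum_congr rfl fun α _ => Finset.sum_congr rfl fun β _ => ?_
    rw [Matrix.smul_single, smul_eq_mul, mul_one]
  have hA : A = fun s => ∑ α, ∑ β, A s α β • Matrix.single α β (1 : ℂ) := funext fun s => hdec (A s)
  rw [hA, hdec A']
  refine HasDerivAt.fun_sum fun α _ => ?_
  refine HasDerivAt.fun_sum fun β _ => ?_
  exact (h α β).smul_const (Matrix.single α β (1 : ℂ))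

/-! ## §2 Products -/

/-- [folklore] Leibniz for a product of matrix curves. -/
theorem hasDerivAt_matrix_mul {A B : ℝ → Matrix ι ι ℂ} {A' B' : Matrix ι ι ℂ} {t : ℝ} (hA : HasDerivAt A A' t) (hB : HasDerivAt B B' t) :
    HasDerivAt (fun s => A s * B s) (A' * B t + A t * B') t :=
  hA.mul hB

/-- [folklore] **LEIBNIZ, ENTRYWISE**: from entrywise derivatives of `A` and `B`, `((A·B) α β)′ = (A′·B + A·B′) α β`. -/
theorem hasDerivAt_mul_entry {A B : ℝ → Matrix ι ι ℂ} {A' B' : Matrix ι ι ℂ} {t : ℝ}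
    (hA : ∀ α β, HasDerivAt (fun s => A s α β) (A' α β) t) (hB : ∀ α β, HasDerivAt (fun s => B s α β) (B' α β) t) (α β : ι) :
    HasDerivAt (fun s => (A s * B s) α β) ((A' * B t + A t * B') α β) t :=
  hasDerivAt_entry (hasDerivAt_matrix_mul (hasDerivAt_of_entries hA) (hasDerivAt_of_entries hB)) α β

/-! ## §3 The inverse -/

/-- [folklore] **DERIVATIVE OF THE INVERSE ALONG A CURVE OF COMPLEX MATRICES**: `(A⁻¹)′ = −A⁻¹·A′·A⁻¹` at a point where `det A` is a unit
(Mathlib `hasFDerivAt_ringInverse`; `Matrix.nonsing_inv_eq_ringInverse`). -/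
theorem hasDerivAt_matrix_inv {A : ℝ → Matrix ι ι ℂ} {A' : Matrix ι ι ℂ} {t : ℝ}
    (h : HasDerivAt A A' t) (hdet : IsUnit (A t).det) :
    HasDerivAt (fun s => (A s)⁻¹) (-((A t)⁻¹ * A' * (A t)⁻¹)) t := by
  obtain ⟨u, hu⟩ := (Matrix.isUnit_iff_isUnit_det _).2 hdet
  have key := hasFDerivAt_ringInverse (𝕜 := ℝ) u
  rw [hu] at key
  have h2 := key.comp_hasDerivAt t h
  simp only [_root_.neg_apply, ContinuousLinearMap.mulLeftRight_apply] at h2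
  have hinv : ((u⁻¹ : (Matrix ι ι ℂ)ˣ) : Matrix ι ι ℂ) = (A t)⁻¹ := by
    rw [Matrix.coe_units_inv, hu]
  rw [hinv] at h2
  refine h2.congr_of_eventuallyEq (Eventually.of_forall fun s => ?_)
  exact Matrix.nonsing_inv_eq_ringInverse (A s)

/-- [folklore] **THE ENTRYWISE FORMULA** from ENTRYWISE hypotheses: `((A⁻¹) α β)′ = −Σ_γ Σ_δ A⁻¹ α γ · A′ γ δ · A⁻¹ δ β`. -/
theorem hasDerivAt_inv_entry {A : ℝ → Matrix ι ι ℂ} {A' : Matrix ι ι ℂ} {t : ℝ}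
    (h : ∀ α β, HasDerivAt (fun s => A s α β) (A' α β) t) (hdet : IsUnit (A t).det) (α β : ι) :
    HasDerivAt (fun s => (A s)⁻¹ α β) (-(∑ γ, ∑ δ, (A t)⁻¹ α γ * A' γ δ * (A t)⁻¹ δ β)) t := by
  have hM := hasDerivAt_entry (hasDerivAt_matrix_inv (hasDerivAt_of_entries h) hdet) α β
  have hform : (-((A t)⁻¹ * A' * (A t)⁻¹)) α β = -(∑ γ, ∑ δ, (A t)⁻¹ α γ * A' γ δ * (A t)⁻¹ δ β) := by
    rw [Matrix.neg_apply, Matrix.mul_apply]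
    congr 1
    rw [Finset.sum_comm]
    refine Finset.sum_congr rfl fun γ _ => ?_
    rw [Matrix.mul_apply, Finset.sum_mul]
  rw [hform] at hM
  exact hM

/-- [folklore] the inverse curve is differentiable (hence continuous) at such a point, entrywise. -/
theorem differentiableAt_inv_entry {A : ℝ → Matrix ι ι ℂ} {A' : Matrix ι ι ℂ} {t : ℝ}
    (h : ∀ α β, HasDerivAt (fun s => A s α β) (A' α β) t) (hdet : IsUnit (A t).det) (α β : ι) :
    DifferentiableAt ℝ (fun s => (A s)⁻¹ α β) t :=
  (hasDerivAt_inv_entry h hdet α β).differentiableAt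

end Summit.QuantumFields.BalabanUV.Beta.FP.MatrixInvDeriv

end
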